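/-
Copyright (c) 2026 the pub-hodgecm-mathlib formalisation cell (harness21).  Prover seat hodgecm-mathlib-K2E1-p10 (g6), Track B ∕ K2-LIT, h413 =
`stmt-HodgeConjecture-24833`, route `HCCMUnconditional`; R90-TF S8 «ContSpec-n½», S8 dealer R90-CS-plan (g3) S8-R220 ∕ S8-R223 (J-S8-ADM) ∕ S8-R226:
«(M) FILE 2 = ED. 2 `…IsPiNOfLettersV2` binding ★ isotypic + K2Liu-p10's ORIENT + K2E1-p14's SPLIT-LQ BY NAME».
-/
import Summits.HodgeConjecture.HodgeConjecture.Theorems.R90S8ResMiddleResidueIsPiNOfLettersU3          -- ★ p864436 (this seat) ED. 1: `res_middleResidue_isPiN_of_letters`, `isoLetter_of_keysLabels` (+ ★ Keys over `keysCaseTwo_holds`)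
import Summits.HodgeConjecture.HodgeConjecture.Theorems.R90S8SplitPlaceLanglandsQuotientU3Statement      -- ★ p864513 (K2E1-p14) SPLIT-LQ consumer `irrClass_mk_mem_cmSplitPacket_members_of_oneLinkQuotient` over ★ p864492 `Zelevinsky1980.parabolicIndGL_three_oneLink_quotient_equiv_detChar`
import Literature.NumberTheory.Rogawski1990.U3PrincipalSeriesKeysOrientation                            -- ★ p864632 (K2Liu-p10) THE ORIENT LETTER `Rogawski1990.KeysOrientation`
import HarnessLib

/-!
# R90 · S8 «ContSpec-n½» — `R90S8ResMiddleResidueIsPiNOfLettersV2U3`: the (M) socket `sock_S8_res_middleResidue_isPiN` (B ED. 7 :299) HYPOTHESIS-FIRST, ED. 2 —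
# the per-place pins of ED. 1 REPLACED by «the local constituents of `P′` are irreducible QUOTIENTS of the induced representation at the residual exponent», modulo the two
# printed local letters ORIENT (★ `Rogawski1990.KeysOrientation`) and SPLIT-LQ (★ `Zelevinsky1980.parabolicIndGL_three_oneLink_quotient_equiv_detChar`)
# [Rogawski1990 §11.4 p. 164, §12.2 (2)–(3) pp. 173–174, §13.9 (ii) p. 229; Zelevinsky1980 Thm. 6.1 (a); Keys1984 §7]

Cell `pub/hodgecm-mathlib`, crux H413 = `stmt-HodgeConjecture-24833` (lane `--kind proof --supports stmt-HodgeConjecture-24833 --as helper`), route of record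
`HCCMUnconditional`; programme R90-TF, section S8; hand K2E1-p10 (g6).  THEOREMS ONLY: no `def`, no `instance`, no `notation`, no `sorry`, NO `Lines` import; the two
printed letters enter as NAMED HYPOTHESES `(hKO : KeysOrientation L)`, `(hLQ : Zelevinsky1980.parabolicIndGL_three_oneLink_quotient_equiv_detChar)` (★ Literature `def … : Prop`s —
this file is CONDITIONAL on them by design, as S8-R220 asks).  CLOSES NO SOCKET: (M) :299 keeps its `sorry`.

THE MATHEMATICS.  ED. 1 (★ `res_middleResidue_isPiN_of_letters`) typed :299 from two abstract pins — (SPLIT) «every `v`-constituent of `P′` is the member of `ξ`'s split packet»,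
(ISO) «every `v`-constituent of `P′` is `πⁿ(ξ_v) ∘ e⁻¹`, `πⁿ` = THE non-`L²` non-supercuspidal constituent of `i_G(χ_{ξ,v})`».  The residue calculus delivers something ONE step
earlier: the local constituents of the middle-residue representation are QUOTIENTS of the induced representation at the residual exponent (`Im M₋₁ ≅ ⊗′_v N_v(I_v)`, RES-INT ∕ FACT-N
[MW IV.1.11, V.3.13; Langlands §7]).  Two printed LOCAL facts turn «quotient» into ED. 1's pins: at a NON-SPLIT `v`, ORIENT [§11.4, §12.2 (2): `πⁿ(ξ_v)` is the Langlands QUOTIENT of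
`i_G(χ_ξ)`, `χ_ξ` positive; every irreducible quotient is `πⁿ`] and at a SPLIT `v`, SPLIT-LQ [Zelevinsky Thm. 6.1 (a): the irreducible quotient of `ν₀ν^{½} × χ′ × ν₀ν^{−½}` is
`(ν₀∘det₂) × χ′ = splitMemberGL ν₀ χ′`].  THIS FILE is that composition: head `res_middleResidue_isPiN_of_quotients` with the letters
* `hLQ` (SPLIT-LQ, printed), `hKO` (ORIENT, printed);
* (QUOT-S) at a SPLIT `v`: every `v`-constituent class `c` of `P′` is the class of a smooth irreducible `π` of `U(J)(L⁺_v)` whose transport `π ∘ cmSplitEquiv⁻¹` to `GL₃(L_w)` (`w` the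
  fixed witness) is a QUOTIENT of the principal series `I ![ν₀ν^{½}, χ′, ν₀ν^{−½}]`, `ν₀ = ξ.splitν₀ μω w`, `χ′ = ξ.locψ w` (★ p864513's binders BYTE FOR BYTE);
* (QUOT-N) at a NON-SPLIT `v`: along some frame `e = cmDatumLocalCongr L v T ha h`, every `v`-constituent class `c` has `comap e c = ⟦r⟧` for a smooth irreducible `r` of the model
  `U(Φ₃)(L⁺_v)` ISOMORPHIC TO A QUOTIENT `i_G(χ_{ξ,v}) ∕ N` by a `G`-stable `N` (★ `KeysOrientation`'s clause (ii) binders BYTE FOR BYTE);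
conclusion = the socket's ∃-body byte for byte (§2; §1 `isoLetter_of_keysLabels_pin` is ED. 1's (M-e) with the ∃-witness TIED to the pin — ED. 1's last clause names `πn`).  PROOF: (SPLIT) := ★ `irrClass_mk_mem_cmSplitPacket_members_of_oneLinkQuotient hLQ π q hq`; (ISO) := ★ `isoLetter_of_keysLabels` at Keys
labels `(π², πⁿ)` for ONE Haar measure `μZ` on the model quotient (Mathlib `Measure.haar` on `Gqs L v ⧸ Z` — ★ `locallyCompactSpace_cmDatum_local`; labels by ★
`exists_keysLabels_sqInt_xi` over ★ `keysCaseTwo_holds`), the weak pin «`comap e c` is a non-`L²` constituent» being ORIENT's clause (ii) (`⟦r⟧ = πⁿ`, a constituent, not `L²` at `μZ`).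

VISIBLE LETTERS AFTER THIS FILE (S8-R220's target set): ORIENT `hKO` (printed ★ def), SPLIT-LQ `hLQ` (printed ★ def), and the QUOTIENT pins (QUOT-S)∕(QUOT-N) ⟸ {RES-INT (★ lines 1, 3, 4–5;
line 2 ★ (T_f); line 6 LH4-p10), FACT-N local analytic (J-S8-FN (b) ★ at good places ∕ (c)), ESTATE T at blocks, `hW1`, ADM = ★ `hAF` junction p864593 (one class per place), ★ isotypic p864408}.
The ADM binder `hAF` is consumed by the PAYER of (QUOT-S)∕(QUOT-N) (the line-7 packaging), not here: binding it unused would be an idle hypothesis.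

HONEST LABEL: HC_CM is proved only modulo the 7 printed citations (2 remaining named inputs: hLiu418 = `stmt-HodgeConjecture-24832`, h413 = `stmt-HodgeConjecture-24833`) until
rung 0 closes; an OF-LETTERS head over two NAMED printed letters pays nothing by itself — (M) :299 stays `sorry`; REL ≠ ★ ≠ BUILT; count-neutral.

## References
* [Rogawski1990] J. D. Rogawski, *Automorphic Representations of Unitary Groups in Three Variables*, Ann. of Math. Stud. 123 (1990), §4.13 Lemma 4.13.1 (b); §11.4 p. 164;
  §12.2 (2)–(3) pp. 173–174; §13.1 p. 199; §13.3 p. 201; §13.9 (ii) p. 229.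
* [Zelevinsky1980] A. V. Zelevinsky, *Induced representations of reductive p-adic groups II*, Ann. Sci. ÉNS 13 (1980), Thm. 4.2, Thm. 6.1 (a), 9.1.
* [Keys1984] D. Keys, *Principal series representations of special unitary groups over local fields*, Compositio Math. 51 (1984), §7.
* [MoeglinWaldspurger1995] C. Mœglin, J.-L. Waldspurger, *Spectral Decomposition and Eisenstein Series* (1995), IV.1.11, V.3.13.
-/

set_option autoImplicit false
-- the mandated namespace repeats the single-problem summit's segment (`HodgeConjecture.HodgeConjecture`)
set_option linter.dupNamespace false

noncomputable section

open MeasureTheory NumberField IsDedekindDomain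
open scoped Matrix MatrixGroups
open Literature.NumberTheory.GaloisRepresentations Literature.NumberTheory.Automorphic.Arthur2013.Leaves.TECR
open Literature.NumberTheory.GaloisRepresentations.IsNonarchimedeanLocalField
open Literature.NumberTheory.Automorphic Literature.NumberTheory.Automorphic.UnitaryGroup Literature.NumberTheory.Rogawski1990

namespace Summit.HodgeConjecture.HodgeConjecture.R90.S8

variable (L : Type) [Field L] [NumberField L] [IsCMField L]

/-! ## §1 The (ISO) pin with the witness TIED (ED. 1's `isoLetter_of_keysLabels` names `πn` in its last clause; here the ∃-witness IS that `πn`) -/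

set_option maxHeartbeats 800000 in -- as ★ `isoLetter_of_keysLabels` (the statement spells ★ `cmPrincipalSeries` three times)
/-- **(M-e), tied form `isoLetter_of_keysLabels_pin`** — the same hypotheses as ★ `isoLetter_of_keysLabels` (a frame, Keys labels `(π², πⁿ)` at `(μω_v, η_v, ψ_v)`, `πⁿ` not `L²` at ONE
Haar measure `μZ₀` on the model quotient, and the weak pin «every `v`-constituent's transport is a non-`L²` constituent of `i_G(χ_{ξ,v})`»), with the conclusion in EXACTLY the (ISO) shape
of ★ `res_middleResidue_isPiN_of_letters`: ONE class `x` (here `x := πⁿ`) which is a constituent, not supercuspidal (★ `not_isSupercuspidal_of_not_isSquareIntegrable_gqs`), not `L²` for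
ANY Haar measure on ANY Borel structure (★ rigidity `keysLabelsCM_isSquareIntegrable_of_isHaarMeasure`; Borel structures coincide), AND pins every constituent: `c = x ∘ e⁻¹` (★ ED. 1's
last clause). [cite: Rogawski1990, §12.2 (2)–(3) pp. 173–174] [cite: Keys1984, §7 Thm. p. 126] -/
theorem isoLetter_of_keysLabels_pin (μω : HeckeCharacter L)
    (hμω : ∀ x : Literature.NumberTheory.GaloisRepresentations.ideleGroup ↥(maximalRealSubfield L),
      μω (AdeleRing.ideleBaseChange (↥(maximalRealSubfield L)) L x) = quadraticHeckeCharCM L x)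
    (ξ : OneDimAutRepH L) {v : HeightOneSpectrum (𝓞 ↥(maximalRealSubfield L))}
    (hns : ∀ w : PlacesOver L v, IsCMField.complexConj L • w.1 = w.1)
    (T : GL (Fin 3) (LocalRing L v)) (a : LocalRing L v) (ha : IsUnit a)
    (h : formCongr (conjLocal L (IsCMField.complexConj L) v) T (((StdForm.antidiagonal 3).over L).map (algebraMap L (LocalRing L v))) =
      a • (Matrix.of fun i j : Fin 3 => if i.val + j.val + 1 = 3 then (1 : L) else 0).map (algebraMap L (LocalRing L v)))
    {m₀ : MeasurableSpace (Gqs L v ⧸ Subgroup.center (Gqs L v))} [@BorelSpace (Gqs L v ⧸ Subgroup.center (Gqs L v)) _ m₀]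
    (μZ₀ : @Measure (Gqs L v ⧸ Subgroup.center (Gqs L v)) m₀) [μZ₀.IsHaarMeasure]
    {π2 πn : IrrClass (Gqs L v)}
    (hK : KeysCaseTwoLabels L v (μω.semilocalComponent L v) (torusLocalComponent L (IsCMField.complexConj L) v ξ.η)
      (torusLocalComponent L (IsCMField.complexConj L) v ξ.ψ) π2 πn)
    (hn : ¬ πn.IsSquareIntegrable μZ₀)
    {μ : Measure (quasiSplit (↥(maximalRealSubfield L)) L (IsCMField.complexConj L) 3).automorphicQuotient}
    [(quasiSplit (↥(maximalRealSubfield L)) L (IsCMField.complexConj L) 3).IsAutomorphicMeasure μ]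
    (P' : DiscreteAutomorphicRep (quasiSplit (↥(maximalRealSubfield L)) L (IsCMField.complexConj L) 3) μ)
    (hcon : ∀ c : IrrClass ((quasiSplit (↥(maximalRealSubfield L)) L (IsCMField.complexConj L) 3).Local v),
      (IrrClass.comap (localPiEquiv L (IsCMField.complexConj L) 3 ((StdForm.antidiagonal 3).over L) v) c).IsConstituentOf
          (P'.finRep.smoothPart.toRepresentation.comp
            (inclPlace (↥(maximalRealSubfield L)) L (IsCMField.complexConj L) 3 ((StdForm.antidiagonal 3).over L) v)) →
        (IrrClass.comap (cmDatumLocalCongr L v T ha h) c).IsConstituentOf (cmPrincipalSeries L 3 v (cmXiTorusChar L v (μω.semilocalComponent L v)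
          (torusLocalComponent L (IsCMField.complexConj L) v ξ.η) (torusLocalComponent L (IsCMField.complexConj L) v ξ.ψ))) ∧
        ¬ (IrrClass.comap (cmDatumLocalCongr L v T ha h) c).IsSquareIntegrable μZ₀) :
    ∃ (T : GL (Fin 3) (LocalRing L v)) (a : LocalRing L v) (ha : IsUnit a)
      (h : formCongr (conjLocal L (IsCMField.complexConj L) v) T (((StdForm.antidiagonal 3).over L).map (algebraMap L (LocalRing L v))) =
        a • (Matrix.of fun i j : Fin 3 => if i.val + j.val + 1 = 3 then (1 : L) else 0).map (algebraMap L (LocalRing L v)))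
      (x : IrrClass (Gqs L v)),
      x.IsConstituentOf (cmPrincipalSeries L 3 v (cmXiTorusChar L v (μω.semilocalComponent L v)
        (torusLocalComponent L (IsCMField.complexConj L) v ξ.η) (torusLocalComponent L (IsCMField.complexConj L) v ξ.ψ))) ∧
      ¬ x.IsSupercuspidal ∧
      (∀ [MeasurableSpace (Gqs L v ⧸ Subgroup.center (Gqs L v))] [BorelSpace (Gqs L v ⧸ Subgroup.center (Gqs L v))]
          (μZ : Measure (Gqs L v ⧸ Subgroup.center (Gqs L v))) [μZ.IsHaarMeasure], ¬ x.IsSquareIntegrable μZ) ∧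
      ∀ c : IrrClass ((quasiSplit (↥(maximalRealSubfield L)) L (IsCMField.complexConj L) 3).Local v),
        (IrrClass.comap (localPiEquiv L (IsCMField.complexConj L) 3 ((StdForm.antidiagonal 3).over L) v) c).IsConstituentOf
            (P'.finRep.smoothPart.toRepresentation.comp
              (inclPlace (↥(maximalRealSubfield L)) L (IsCMField.complexConj L) 3 ((StdForm.antidiagonal 3).over L) v)) →
          c = IrrClass.comap (cmDatumLocalCongr L v T ha h).symm x := by
  obtain ⟨T', a', ha', h', -, -, -, -, hpin⟩ := isoLetter_of_keysLabels L μω hμω ξ hns T a ha h μZ₀ hK hn P' hcon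
  refine ⟨T', a', ha', h', πn, (hK.2 πn).2 (Or.inl rfl),
    Cruxes.H413.F0P3cStCharTSNe.not_isSupercuspidal_of_not_isSquareIntegrable_gqs L v hns μZ₀ hn, ?_, hpin⟩
  intro m _ μZ _
  have hm : m = m₀ := by
    rw [@BorelSpace.measurable_eq (Gqs L v ⧸ Subgroup.center (Gqs L v)) _ m ‹_›,
      @BorelSpace.measurable_eq (Gqs L v ⧸ Subgroup.center (Gqs L v)) _ m₀ ‹_›]
  subst hm
  exact (Cruxes.H413.F0P3cDbTKeysLabelRigidity.keysLabelsCM_isSquareIntegrable_of_isHaarMeasure μω hμω ξ hns μZ₀ μZ hK hn).2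

/-! ## §2 The head: (M) :299 from the QUOTIENT pins, modulo ORIENT and SPLIT-LQ -/

set_option synthInstance.maxHeartbeats 400000 in
set_option maxHeartbeats 4000000 in -- measured: the statement spells ★ `cmPrincipalSeries` + `Representation.quotient` (★ `KeysOrientation`'s 4M budget) and ★ `parabolicIndGL` + ★ `cmSplitPacket` (★ p864513's frame)
/-- **(M) :299 OF QUOTIENTS — `res_middleResidue_isPiN_of_quotients` (ED. 2 of ★ `res_middleResidue_isPiN_of_letters`).**  The frame of FILE B ED. 7 :299 (`(L μ μω hμu) (hμω) (ξ) (P′)`)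
with `hP′le` replaced by: the printed letters `hLQ` (SPLIT-LQ ★ `Zelevinsky1980.parabolicIndGL_three_oneLink_quotient_equiv_detChar`) and `hKO` (ORIENT ★ `Rogawski1990.KeysOrientation`), and the
two QUOTIENT pins — (QUOT-S) at a split `v`, every `v`-constituent class of `P′` is `⟦π⟧` for a smooth irreducible `π` of `U(J)(L⁺_v)` whose transport to `GL₃(L_w)` at the fixed witness is an
irreducible QUOTIENT (`q` surjective) of the principal series `I ![ν₀ν^{½}, χ′, ν₀ν^{−½}]`, `(ν₀, χ′) = (ξ.splitν₀ μω w, ξ.locψ w)` (★ p864513's binders byte for byte); (QUOT-N) at a non-split `v`,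
along some frame `e`, every `v`-constituent class `c` has `comap e c = ⟦r⟧` with `r ≅ i_G(χ_{ξ,v}) ∕ N` (★ `KeysOrientation` (ii)'s binders byte for byte).  CONCLUSION = the socket's ∃-body
BYTE FOR BYTE.  Proof = ★ ED. 1 head with (SPLIT) := ★ K2E1-p14's consumer and (ISO) := ★ `isoLetter_of_keysLabels` ∘ ORIENT (ii) at Keys labels for ONE Haar measure on `U(Φ₃)(L⁺_v) ⧸ Z`
(Mathlib `Measure.haar`; labels ★ `exists_keysLabels_sqInt_xi`).  VISIBLE after this file: {`hKO`, `hLQ`, (QUOT-S), (QUOT-N)} — the quotient pins are RES-INT ∘ FACT-N ∘ T ∘ `hW1` ∘ ADM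
(`hAF`, ★ p864593) ∘ ★ isotypic, i.e. the line-7 packaging's output.
[cite: Rogawski1990, §11.4 p. 164; §12.2 (2)–(3) pp. 173–174; §13.9 (ii) p. 229; §13.3 p. 201] [cite: Zelevinsky1980, Thm. 6.1 (a)] [cite: Keys1984, §7] -/
theorem res_middleResidue_isPiN_of_quotients
    (μ : Measure (quasiSplit (↥(maximalRealSubfield L)) L (IsCMField.complexConj L) 3).automorphicQuotient)
    [(quasiSplit (↥(maximalRealSubfield L)) L (IsCMField.complexConj L) 3).IsAutomorphicMeasure μ]
    (μω : HeckeCharacter L) (hμu : μω.IsUnitary)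
    (hμω : ∀ x : Literature.NumberTheory.GaloisRepresentations.ideleGroup ↥(maximalRealSubfield L),
      μω (AdeleRing.ideleBaseChange (↥(maximalRealSubfield L)) L x) = quadraticHeckeCharCM L x)
    (ξ : OneDimAutRepH L) (P' : DiscreteAutomorphicRep (quasiSplit (↥(maximalRealSubfield L)) L (IsCMField.complexConj L) 3) μ)
    -- the two printed local letters
    (hLQ : Zelevinsky1980.parabolicIndGL_three_oneLink_quotient_equiv_detChar) (hKO : KeysOrientation L)
    -- (QUOT-S): at a split place every local constituent of `P′` is an irreducible QUOTIENT of the split principal series at the residual exponent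
    (hQUOTs : ∀ (v : HeightOneSpectrum (𝓞 ↥(maximalRealSubfield L))) (hs : ∃ w : PlacesOver L v, IsCMField.complexConj L • w.1 ≠ w.1)
      (c : IrrClass ((quasiSplit (↥(maximalRealSubfield L)) L (IsCMField.complexConj L) 3).Local v)),
      (IrrClass.comap (localPiEquiv L (IsCMField.complexConj L) 3 ((StdForm.antidiagonal 3).over L) v) c).IsConstituentOf
          (P'.finRep.smoothPart.toRepresentation.comp
            (inclPlace (↥(maximalRealSubfield L)) L (IsCMField.complexConj L) 3 ((StdForm.antidiagonal 3).over L) v)) →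
        ∃ (π : SmoothIrrep ((cmDatum L 3 ((StdForm.antidiagonal 3).over L)).Local v)), IrrClass.mk π = c ∧
          ∃ q : (Representation.parabolicIndGL ((splitWitness v hs).1.adicCompletion L) (id : Fin 3 → Fin 3)
              ((Representation.trivial ℂ (Π a : Fin 3, GL {i : Fin 3 // (id : Fin 3 → Fin 3) i = a} ((splitWitness v hs).1.adicCompletion L)) ℂ).twist
                (∏ a : Fin 3, ((![ξ.splitν₀ μω (splitWitness v hs).1 *
                        ((unramifiedTwist ((splitWitness v hs).1.adicCompletion L) (1 / 2) : QuasiChar ((splitWitness v hs).1.adicCompletion L)).toMonoidHom),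
                      ξ.locψ (splitWitness v hs).1,
                      ξ.splitν₀ μω (splitWitness v hs).1 *
                        ((unramifiedTwist ((splitWitness v hs).1.adicCompletion L) (1 / 2) : QuasiChar ((splitWitness v hs).1.adicCompletion L)).toMonoidHom)⁻¹] :
                    Fin 3 → (((splitWitness v hs).1.adicCompletion L)ˣ →* ℂˣ)) a).comp
                  (Matrix.GeneralLinearGroup.det.comp (Pi.evalMonoidHom (fun a : Fin 3 => GL {i : Fin 3 // (id : Fin 3 → Fin 3) i = a} ((splitWitness v hs).1.adicCompletion L)) a))))).IntertwiningMap
              (π.comap (cmSplitEquiv L ((StdForm.antidiagonal 3).over L) (UnitaryGroup.cmConj_antidiagonal_transpose L 3)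
                ((Matrix.isUnit_iff_isUnit_det _).mp (StdForm.isUnit_over (StdForm.antidiagonal 3) L)) v (splitWitness v hs) (splitWitness_spec v hs)).symm).ρ,
            Function.Surjective q)
    -- (QUOT-N): at a non-split place, along some frame, every local constituent of `P′` is (the transport of) an irreducible QUOTIENT of `i_G(χ_{ξ,v})`
    (hQUOTn : ∀ (v : HeightOneSpectrum (𝓞 ↥(maximalRealSubfield L))), (∀ w : PlacesOver L v, IsCMField.complexConj L • w.1 = w.1) →
      ∃ (T : GL (Fin 3) (LocalRing L v)) (a : LocalRing L v) (ha : IsUnit a)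
        (h : formCongr (conjLocal L (IsCMField.complexConj L) v) T (((StdForm.antidiagonal 3).over L).map (algebraMap L (LocalRing L v))) =
          a • (Matrix.of fun i j : Fin 3 => if i.val + j.val + 1 = 3 then (1 : L) else 0).map (algebraMap L (LocalRing L v))),
        ∀ c : IrrClass ((quasiSplit (↥(maximalRealSubfield L)) L (IsCMField.complexConj L) 3).Local v),
          (IrrClass.comap (localPiEquiv L (IsCMField.complexConj L) 3 ((StdForm.antidiagonal 3).over L) v) c).IsConstituentOf
              (P'.finRep.smoothPart.toRepresentation.comp
                (inclPlace (↥(maximalRealSubfield L)) L (IsCMField.complexConj L) 3 ((StdForm.antidiagonal 3).over L) v)) →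
            ∃ (r : SmoothIrrep (Gqs L v))
              (N : Subrepresentation (cmPrincipalSeries L 3 v (cmXiTorusChar L v (μω.semilocalComponent L v)
                (torusLocalComponent L (IsCMField.complexConj L) v ξ.η) (torusLocalComponent L (IsCMField.complexConj L) v ξ.ψ)))),
              IrrClass.comap (cmDatumLocalCongr L v T ha h) c = IrrClass.mk r ∧
              Nonempty (r.ρ.Equiv ((cmPrincipalSeries L 3 v (cmXiTorusChar L v (μω.semilocalComponent L v)
                (torusLocalComponent L (IsCMField.complexConj L) v ξ.η) (torusLocalComponent L (IsCMField.complexConj L) v ξ.ψ))).quotient N.toSubmodule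
                  fun g _ hx => N.apply_mem_toSubmodule g hx))) :
    ∃ Pv : ∀ v : HeightOneSpectrum (𝓞 ↥(maximalRealSubfield L)), CMLocalAPacket L ((StdForm.antidiagonal 3).over L) v,
      ξ.IsXiLocalFamily (UnitaryGroup.cmConj_antidiagonal_transpose L 3)
          ((Matrix.isUnit_iff_isUnit_det _).mp (StdForm.isUnit_over (StdForm.antidiagonal 3) L)) μω hμu Pv ∧
      LocalConstituentsIn P' Pv ∧
      ∀ v : HeightOneSpectrum (𝓞 ↥(maximalRealSubfield L)),
        (∀ w : PlacesOver L v, IsCMField.complexConj L • w.1 = w.1) →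
        ∀ c : IrrClass ((quasiSplit (↥(maximalRealSubfield L)) L (IsCMField.complexConj L) 3).Local v), c ∈ (Pv v).members →
          ¬ c.IsSupercuspidal ∧
          ∀ [MeasurableSpace ((quasiSplit (↥(maximalRealSubfield L)) L (IsCMField.complexConj L) 3).Local v ⧸
                Subgroup.center ((quasiSplit (↥(maximalRealSubfield L)) L (IsCMField.complexConj L) 3).Local v))]
            [BorelSpace ((quasiSplit (↥(maximalRealSubfield L)) L (IsCMField.complexConj L) 3).Local v ⧸
                Subgroup.center ((quasiSplit (↥(maximalRealSubfield L)) L (IsCMField.complexConj L) 3).Local v))]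
            (μZ : Measure ((quasiSplit (↥(maximalRealSubfield L)) L (IsCMField.complexConj L) 3).Local v ⧸
                Subgroup.center ((quasiSplit (↥(maximalRealSubfield L)) L (IsCMField.complexConj L) 3).Local v)))
            [μZ.IsHaarMeasure], ¬ c.IsSquareIntegrable μZ := by
  refine res_middleResidue_isPiN_of_letters L μ μω hμu hμω ξ P' (fun v hs c hc => ?_) (fun v hns => ?_)
  · -- (SPLIT) from (QUOT-S) and SPLIT-LQ: the constituent IS the split packet's member
    obtain ⟨π, hπc, q, hq⟩ := hQUOTs v hs c hc
    rw [← hπc]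
    exact irrClass_mk_mem_cmSplitPacket_members_of_oneLinkQuotient L ((StdForm.antidiagonal 3).over L) (UnitaryGroup.cmConj_antidiagonal_transpose L 3)
      ((Matrix.isUnit_iff_isUnit_det _).mp (StdForm.isUnit_over (StdForm.antidiagonal 3) L)) v (splitWitness v hs) (splitWitness_spec v hs)
      (ξ.splitν₀ μω (splitWitness v hs).1) (ξ.locψ (splitWitness v hs).1) (ξ.norm_splitν₀_apply hμu (splitWitness v hs).1)
      (ξ.continuous_splitν₀ μω (splitWitness v hs).1) (ξ.norm_locψ_apply (splitWitness v hs).1) (ξ.continuous_locψ (splitWitness v hs).1) hLQ π q hq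
  · -- (ISO) from (QUOT-N) and ORIENT at Keys labels for ONE Haar measure on the model quotient
    obtain ⟨T, a, ha, h, hq⟩ := hQUOTn v hns
    letI : MeasurableSpace (Gqs L v ⧸ Subgroup.center (Gqs L v)) := borel _
    haveI : BorelSpace (Gqs L v ⧸ Subgroup.center (Gqs L v)) := ⟨rfl⟩
    obtain ⟨π2, πn, hK, h2, hn⟩ := Cruxes.H413.F0P3cStCharTSPi2SqInt.exists_keysLabels_sqInt_xi L μω hμω ξ v hns (Measure.haar : Measure (Gqs L v ⧸ Subgroup.center (Gqs L v)))
    refine isoLetter_of_keysLabels_pin L μω hμω ξ hns T a ha h Measure.haar hK hn P' fun c hc => ?_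
    obtain ⟨r, N, hcr, ⟨e⟩⟩ := hq c hc
    have hori := hKO v hns (μω.semilocalComponent L v) (torusLocalComponent L (IsCMField.complexConj L) v ξ.η) (torusLocalComponent L (IsCMField.complexConj L) v ξ.ψ)
      (isQuadraticCharExtension_semilocalComponent_of_baseChange_eq μω hμω v) (Units.continuous_val.comp (continuous_semilocalComponent L μω))
      (continuous_torusLocalComponent L (IsCMField.complexConj L) ξ.η) (continuous_torusLocalComponent L (IsCMField.complexConj L) ξ.ψ) Measure.haar π2 πn hK h2 hn
    have hr : IrrClass.mk r = πn := hori.2.1 r N ⟨e⟩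
    rw [hcr, hr]
    exact ⟨(hK.2 πn).2 (Or.inl rfl), hn⟩

end Summit.HodgeConjecture.HodgeConjecture.R90.S8

end
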